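import Summits.ValiantsHypothesis.ValiantsHypothesis.Theorems.LacunarySymmetroidMatrixDescartesDoorA26WallBubblingConfluentLimit
import Summits.ValiantsHypothesis.ValiantsHypothesis.Theorems.LacunarySymmetroidMatrixDescartesDoorA26WallBubblingConfluentTower

/-!
# Wall bubbling for `DoorA26` — (W) at generic Weyl faces: THE SINGLE-CLUSTER BRANCH, END TO END, FROM THE CONFLUENT DOOR

HONEST FRAMING.  Obligation (W) `stub_weylFaces` of `Cruxes/DoorA26/Lines/wall_bubbling.lean` (crux `DoorA26`, stmt-ValiantsHypothesis-19979,
`= PosRootLawAt 2 6 19`; OPEN, typed, never asserted); statement file `Cruxes/DoorA26/Lines/wall_bubbling_ConfluentDoor.lean` rev 3 (line lead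
val-idea-15 g3): `ConfluentDoor26` (log-currency, WITH multiplicity), `IsGenericWeylFace`, target shape `Stmt.weylFaces_generic_of_confluentDoor`.
W2 seat val-sym-door-p1 g14.  THIS FILE proves, with the door INLINED VERBATIM as a hypothesis (def-free; `Cruxes/` is not importable):

* `no_twenty_window_weyl05_of_confluentDoor` — CORE: along ANY sequence of genuine real-exponent `(2,6)` pencils
  `t ↦ det Σ_l e^{δ^ν_l t}U^ν_l` (symmetric letters, not identically zero) whose exponents converge to a point with `δ₀ = δ₅` and the five values
  `δ₀,…,δ₄` 2-Sidon (no coincidence of pair sums — the GENERIC Weyl face), twenty zeros in a FIXED window `[A,B]` are impossible, GIVEN the door.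
  (= `…ConfluentLimit.confluentLimit` + W2 #7 `no_twenty_window_of_confluentDoor` p653192.)
* `no_twenty_window_of_confluentDoor_genericWeylFace` — the same at a generic Weyl face `δᵢ = δⱼ` in the line's currency `IsGenericWeylFace δ i j`
  (inlined), by relabelling the letters;
* `no_boundedRatio_twenties_of_confluentDoor` — `x`-currency: GIVEN the door, near a generic Weyl face there is no sequence of twenties
  (`det Σ_l x^{δ^ν_l}S^ν_l = 0` at `0 < x^ν_1 < ⋯ < x^ν_20`) with BOUNDED ROOT RATIO `x^ν_20 ≤ R·x^ν_1`.

WHAT THIS IS AND IS NOT.  It is the «one cluster» (= third-level, report DOOR-A-P1-REPORT §68 (f)) branch of the reduction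
«`ConfluentDoor26` ⇒ `Stmt.weylFaces_generic`», closed in the kernel from entrance to exit: an accumulation of twenties at a generic Weyl face whose
20 log-roots stay at bounded mutual distance is EXACTLY a confluent twenty, which the door forbids.  It is NOT `Stmt.weylFaces_generic_of_confluentDoor`:
accumulations whose log-roots SPLIT into ≥ 2 clusters at mutual distance → ∞ («broken confluent chains») are not excluded by the door — the chain's slot
count caps at 20, not 19, for every number of clusters (seat val-sym-door-p1 g14, bus 2026-08-28T19:18Z: tight example (19,1) at the top Weyl face with
the `t²e^{2t}` slot dead); their exclusion is a multi-scale statement of (R)-type.  Registers unchanged; (W), `ConfluentDoor26`, `DoorA26`,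
`MatrixDescartes` (stmt-ValiantsHypothesis-18050) OPEN; nothing on VP ≠ VNP.  No new definitions.

[this work] the assembly; [folklore] relabelling, logarithmic coordinates.
-/

-- `Summit.ValiantsHypothesis.ValiantsHypothesis.…` repeats a component by the D-0017 layout
-- (single-conjunct summit), which the `dupNamespace` linter flags; the name is mandated.
set_option linter.dupNamespace false

namespace Summit.ValiantsHypothesis.ValiantsHypothesis.Theorems.LacunarySymmetroidMatrixDescartes.WallBubbling

open Finset Filter Topology
open scoped BigOperators

/-! ## 1. The core: positions `0, 5` -/

/-- **NO TWENTY IN A WINDOW AT A GENERIC WEYL FACE, GIVEN THE CONFLUENT DOOR** (Weyl pair at the positions `0, 5`).  The door `ConfluentDoor26`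
(rev 3, log-currency, with multiplicity) is the hypothesis `hdoor`, inlined verbatim. [this work] -/
theorem no_twenty_window_weyl05_of_confluentDoor
    (hdoor : ∀ e : Fin 5 → ℝ, Function.Injective e →
      ∀ τ T : Matrix (Fin 2) (Fin 2) ℝ, ∀ S : Fin 4 → Matrix (Fin 2) (Fin 2) ℝ,
        τ.IsSymm → T.IsSymm → (∀ k, (S k).IsSymm) →
        (∃ t, ((Real.exp (e 0 * t)) • (τ + t • T) + ∑ k, (Real.exp (e k.succ * t)) • S k).det ≠ 0) →
        ∀ (Z : Finset ℝ) (m : ℝ → ℕ),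
          (∀ z ∈ Z, ∀ j < m z,
            iteratedDeriv j (fun t => ((Real.exp (e 0 * t)) • (τ + t • T) + ∑ k, (Real.exp (e k.succ * t)) • S k).det) z = 0) →
          ∑ z ∈ Z, m z ≤ 19)
    (δs : ℕ → Fin 6 → ℝ) (δ0 : Fin 6 → ℝ) (hδ : ∀ l, Tendsto (fun ν => δs ν l) atTop (𝓝 (δ0 l))) (h05 : δ0 5 = δ0 0)
    (hsid : ∀ a b c d : Fin 5, δ0 a.castSucc + δ0 b.castSucc = δ0 c.castSucc + δ0 d.castSucc → (a = c ∧ b = d) ∨ (a = d ∧ b = c))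
    (U : ℕ → Fin 6 → Matrix (Fin 2) (Fin 2) ℝ) (hU : ∀ ν l, (U ν l).IsSymm)
    (hne : ∀ ν, ∃ t, (∑ l, Real.exp (δs ν l * t) • U ν l).det ≠ 0)
    (A B : ℝ) (hz : ∀ ν, ∃ z : Fin 20 → ℝ, StrictMono z ∧ ∀ i, z i ∈ Set.Icc A B ∧ (∑ l, Real.exp (δs ν l * z i) • U ν l).det = 0) :
    False := by
  obtain ⟨φ, hφ, a, τ, T, S, hτ, hT, hS, hne', hconv⟩ := confluentLimit δs δ0 hδ h05 hsid U hU hne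
  obtain ⟨e, he⟩ : ∃ e : Fin 5 → ℝ, ∀ m, e m = δ0 m.castSucc := ⟨fun m => δ0 m.castSucc, fun m => rfl⟩
  have he0 : e 0 = δ0 0 := by rw [he, Fin.castSucc_zero]
  have hes : ∀ k : Fin 4, e k.succ = δ0 k.succ.castSucc := fun k => he k.succ
  have heinj : Function.Injective e := by
    intro a b hab
    rcases hsid a a b b (by rw [← he, ← he, hab]) with h | h
    · exact h.1
    · exact h.1
  have hfun : (fun t : ℝ => ((Real.exp (e 0 * t)) • (τ + t • T) + ∑ k, (Real.exp (e k.succ * t)) • S k).det)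
      = (fun t => ((Real.exp (δ0 0 * t)) • (τ + t • T) + ∑ k : Fin 4, (Real.exp (δ0 k.succ.castSucc * t)) • S k).det) := by
    simp only [he0, hes]
  refine no_twenty_window_of_confluentDoor hdoor e heinj τ T S hτ hT hS (by simp only [he0, hes]; exact hne') A B
    (fun k t => a k * (∑ l, Real.exp (δs (φ k) l * t) • U (φ k) l).det) ?_ ?_ ?_
  · intro k n; exact contDiff_const.mul (contDiff_pencilDet _ _ n)
  · intro j _ ψ hψ t t₀ _ ht
    rw [hfun]
    exact hconv j ψ hψ t t₀ ht
  · intro k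
    obtain ⟨z, hz1, hz2⟩ := hz (φ k)
    exact ⟨z, hz1, fun i => ⟨(hz2 i).1, by rw [(hz2 i).2, mul_zero]⟩⟩

/-! ## 2. Relabelling: any generic Weyl face `δᵢ = δⱼ` -/

/-- A permutation of the six positions sending `5 ↦ j` and `castSucc m ↦ j.succAbove (π m)`. [folklore] -/
theorem exists_perm_weylPair (i j : Fin 6) (hij : i ≠ j) :
    ∃ σ : Equiv.Perm (Fin 6), σ 5 = j ∧ σ 0 = i ∧ ∃ π : Equiv.Perm (Fin 5), ∀ m : Fin 5, σ m.castSucc = j.succAbove (π m) := by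
  obtain ⟨i', hi'⟩ := Fin.exists_succAbove_eq hij
  let π : Equiv.Perm (Fin 5) := Equiv.swap 0 i'
  let σ : Equiv.Perm (Fin 6) := ((finSuccEquiv' (Fin.last 5)).trans (Equiv.optionCongr π)).trans (finSuccEquiv' j).symm
  have hσ : ∀ m : Fin 5, σ m.castSucc = j.succAbove (π m) := by
    intro m
    show (finSuccEquiv' j).symm (Equiv.optionCongr π (finSuccEquiv' (Fin.last 5) m.castSucc)) = _
    rw [← Fin.succAbove_last_apply, finSuccEquiv'_succAbove]
    rfl
  refine ⟨σ, ?_, ?_, π, hσ⟩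
  · show (finSuccEquiv' j).symm (Equiv.optionCongr π (finSuccEquiv' (Fin.last 5) 5)) = j
    rw [show (5 : Fin 6) = Fin.last 5 from rfl, finSuccEquiv'_at]
    rfl
  · rw [show (0 : Fin 6) = (0 : Fin 5).castSucc from rfl, hσ]
    show j.succAbove (Equiv.swap 0 i' 0) = i
    rw [Equiv.swap_apply_left, hi']

/-- 2-Sidon bookkeeping: from the line's `InjOn` on sorted pairs to the unordered-pair statement on `j.succAbove ∘ π`. [folklore] -/
theorem sidon_of_injOn (δ : Fin 6 → ℝ) (j : Fin 6)
    (hinj : Set.InjOn (fun p : Fin 5 × Fin 5 => δ (j.succAbove p.1) + δ (j.succAbove p.2)) {p | p.1 ≤ p.2})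
    (π : Equiv.Perm (Fin 5)) (a b c d : Fin 5)
    (h : δ (j.succAbove (π a)) + δ (j.succAbove (π b)) = δ (j.succAbove (π c)) + δ (j.succAbove (π d))) :
    (a = c ∧ b = d) ∨ (a = d ∧ b = c) := by
  -- sort both pairs
  have key : ∀ x y u v : Fin 5, x ≤ y → u ≤ v →
      δ (j.succAbove x) + δ (j.succAbove y) = δ (j.succAbove u) + δ (j.succAbove v) → x = u ∧ y = v := by
    intro x y u v hxy huv hsum
    have := hinj (show ((x, y) : Fin 5 × Fin 5) ∈ {p : Fin 5 × Fin 5 | p.1 ≤ p.2} from hxy)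
      (show ((u, v) : Fin 5 × Fin 5) ∈ {p : Fin 5 × Fin 5 | p.1 ≤ p.2} from huv) hsum
    exact Prod.mk.inj this
  have hπ : ∀ x y : Fin 5, π x = π y ↔ x = y := fun x y => π.injective.eq_iff
  rcases le_total (π a) (π b) with hab | hab <;> rcases le_total (π c) (π d) with hcd | hcd
  · have := key _ _ _ _ hab hcd h
    rw [hπ, hπ] at this; exact Or.inl this
  · have := key _ _ _ _ hab hcd (by rw [h, add_comm])
    rw [hπ, hπ] at this; exact Or.inr this
  · have := key _ _ _ _ hab hcd (by rw [← h, add_comm])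
    rw [hπ, hπ] at this; exact Or.inr ⟨this.2, this.1⟩
  · have := key _ _ _ _ hab hcd (by rw [add_comm, h, add_comm])
    rw [hπ, hπ] at this; exact Or.inl ⟨this.2, this.1⟩

/-- **NO TWENTY IN A WINDOW AT A GENERIC WEYL FACE `δᵢ = δⱼ`, GIVEN THE CONFLUENT DOOR** — the line's currency: `IsGenericWeylFace δ0 i j`
inlined (`i < j`, `δ0 i = δ0 j`, the 15 pair sums off `j` pairwise distinct). [this work] -/
theorem no_twenty_window_of_confluentDoor_genericWeylFace
    (hdoor : ∀ e : Fin 5 → ℝ, Function.Injective e →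
      ∀ τ T : Matrix (Fin 2) (Fin 2) ℝ, ∀ S : Fin 4 → Matrix (Fin 2) (Fin 2) ℝ,
        τ.IsSymm → T.IsSymm → (∀ k, (S k).IsSymm) →
        (∃ t, ((Real.exp (e 0 * t)) • (τ + t • T) + ∑ k, (Real.exp (e k.succ * t)) • S k).det ≠ 0) →
        ∀ (Z : Finset ℝ) (m : ℝ → ℕ),
          (∀ z ∈ Z, ∀ j < m z,
            iteratedDeriv j (fun t => ((Real.exp (e 0 * t)) • (τ + t • T) + ∑ k, (Real.exp (e k.succ * t)) • S k).det) z = 0) →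
          ∑ z ∈ Z, m z ≤ 19)
    (δ0 : Fin 6 → ℝ) (i j : Fin 6)
    (hgen : i < j ∧ δ0 i = δ0 j ∧
      Set.InjOn (fun p : Fin 5 × Fin 5 => δ0 (j.succAbove p.1) + δ0 (j.succAbove p.2)) {p | p.1 ≤ p.2})
    (δs : ℕ → Fin 6 → ℝ) (hδ : ∀ l, Tendsto (fun ν => δs ν l) atTop (𝓝 (δ0 l)))
    (U : ℕ → Fin 6 → Matrix (Fin 2) (Fin 2) ℝ) (hU : ∀ ν l, (U ν l).IsSymm)
    (hne : ∀ ν, ∃ t, (∑ l, Real.exp (δs ν l * t) • U ν l).det ≠ 0)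
    (A B : ℝ) (hz : ∀ ν, ∃ z : Fin 20 → ℝ, StrictMono z ∧ ∀ i, z i ∈ Set.Icc A B ∧ (∑ l, Real.exp (δs ν l * z i) • U ν l).det = 0) :
    False := by
  obtain ⟨hij, hδij, hinj⟩ := hgen
  obtain ⟨σ, hσ5, hσ0, π, hσ⟩ := exists_perm_weylPair i j (ne_of_lt hij)
  -- relabelled data
  have hsum : ∀ (δ : Fin 6 → ℝ) (V : Fin 6 → Matrix (Fin 2) (Fin 2) ℝ) (t : ℝ),
      ∑ l, Real.exp (δ (σ l) * t) • V (σ l) = ∑ l, Real.exp (δ l * t) • V l :=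
    fun δ V t => Equiv.sum_comp σ (fun l => Real.exp (δ l * t) • V l)
  refine no_twenty_window_weyl05_of_confluentDoor hdoor (fun ν l => δs ν (σ l)) (fun l => δ0 (σ l)) (fun l => hδ (σ l))
    (by rw [hσ5, hσ0, hδij]) ?_ (fun ν l => U ν (σ l)) (fun ν l => hU ν (σ l)) ?_ A B ?_
  · intro a b c d h
    simp only [hσ] at h
    exact sidon_of_injOn δ0 j hinj π a b c d h
  · intro ν
    obtain ⟨t, ht⟩ := hne ν
    exact ⟨t, by rw [hsum]; exact ht⟩
  · intro ν
    obtain ⟨z, hz1, hz2⟩ := hz ν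
    exact ⟨z, hz1, fun k => ⟨(hz2 k).1, by rw [hsum]; exact (hz2 k).2⟩⟩

/-! ## 3. The `x`-currency statement: no bounded-ratio twenties near a generic Weyl face -/

/-- Logarithmic coordinates: `Σ_l x^{δ_l} S_l = Σ_l e^{δ_l t}·(x₀^{δ_l} S_l)` for `x = x₀ e^{t}`. [folklore] -/
theorem pencil_log_recenter (δ : Fin 6 → ℝ) (S : Fin 6 → Matrix (Fin 2) (Fin 2) ℝ) {x₀ x : ℝ} (hx₀ : 0 < x₀) (hx : 0 < x) :
    ∑ l, (x ^ (δ l)) • S l = ∑ l, Real.exp (δ l * (Real.log x - Real.log x₀)) • ((x₀ ^ (δ l)) • S l) := by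
  refine Finset.sum_congr rfl fun l _ => ?_
  rw [smul_smul]
  congr 1
  rw [Real.rpow_def_of_pos hx, Real.rpow_def_of_pos hx₀, ← Real.exp_add]
  congr 1; ring

/-- **NO BOUNDED-RATIO TWENTIES NEAR A GENERIC WEYL FACE, GIVEN THE CONFLUENT DOOR.**  With the door `ConfluentDoor26` (rev 3; inlined verbatim)
as hypothesis: if `δ^ν → δ0`, `δ0` on the generic part of the Weyl face `δᵢ = δⱼ` (`IsGenericWeylFace δ0 i j`, inlined), there is no sequence of
symmetric letters `S^ν` and positive roots `x^ν_1 < ⋯ < x^ν_20` of `det Σ_l x^{δ^ν_l} S^ν_l` (determinant not identically zero on `(0,∞)`) with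
`x^ν_20 ≤ R·x^ν_1` for a fixed `R`.  In the line lead's words (bus 2026-08-28T19:36Z, to be kept verbatim): «GIVEN the door, twenties accumulating
at a generic Weyl face SPLIT (x₂₀/x₁ → ∞) — i.e. what remains of (W) at a generic face is the door on 2-Sidon e plus (W-split), nothing else».  This is
the single-cluster branch of «`ConfluentDoor26` ⇒ `Stmt.weylFaces_generic`»; the split branch (W-split) is NOT covered (module docstring). [this work] -/
theorem no_boundedRatio_twenties_of_confluentDoor
    (hdoor : ∀ e : Fin 5 → ℝ, Function.Injective e →
      ∀ τ T : Matrix (Fin 2) (Fin 2) ℝ, ∀ S : Fin 4 → Matrix (Fin 2) (Fin 2) ℝ,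
        τ.IsSymm → T.IsSymm → (∀ k, (S k).IsSymm) →
        (∃ t, ((Real.exp (e 0 * t)) • (τ + t • T) + ∑ k, (Real.exp (e k.succ * t)) • S k).det ≠ 0) →
        ∀ (Z : Finset ℝ) (m : ℝ → ℕ),
          (∀ z ∈ Z, ∀ j < m z,
            iteratedDeriv j (fun t => ((Real.exp (e 0 * t)) • (τ + t • T) + ∑ k, (Real.exp (e k.succ * t)) • S k).det) z = 0) →
          ∑ z ∈ Z, m z ≤ 19)
    (δ0 : Fin 6 → ℝ) (i j : Fin 6)
    (hgen : i < j ∧ δ0 i = δ0 j ∧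
      Set.InjOn (fun p : Fin 5 × Fin 5 => δ0 (j.succAbove p.1) + δ0 (j.succAbove p.2)) {p | p.1 ≤ p.2})
    (δs : ℕ → Fin 6 → ℝ) (hδ : ∀ l, Tendsto (fun ν => δs ν l) atTop (𝓝 (δ0 l)))
    (S : ℕ → Fin 6 → Matrix (Fin 2) (Fin 2) ℝ) (hS : ∀ ν l, (S ν l).IsSymm)
    (hne : ∀ ν, ∃ y : ℝ, 0 < y ∧ (∑ l, (y ^ (δs ν l)) • S ν l).det ≠ 0)
    (R : ℝ) (x : ℕ → Fin 20 → ℝ) (hx : ∀ ν, StrictMono (x ν)) (hxpos : ∀ ν k, 0 < x ν k)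
    (hxR : ∀ ν k, x ν k ≤ R * x ν 0) (hroot : ∀ ν k, (∑ l, (x ν k ^ (δs ν l)) • S ν l).det = 0) : False := by
  have hR : 0 < R := by
    have h1 := hxR 0 0
    have h2 := hxpos 0 0
    nlinarith
  -- recentred letters and logarithmic roots
  refine no_twenty_window_of_confluentDoor_genericWeylFace hdoor δ0 i j hgen δs hδ
    (fun ν l => (x ν 0 ^ (δs ν l)) • S ν l) (fun ν l => (hS ν l).smul _) ?_ 0 (Real.log R) ?_
  · intro ν
    obtain ⟨y, hy, hdet⟩ := hne ν
    refine ⟨Real.log y - Real.log (x ν 0), ?_⟩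
    rw [← pencil_log_recenter (δs ν) (S ν) (hxpos ν 0) hy]
    exact hdet
  · intro ν
    refine ⟨fun k => Real.log (x ν k) - Real.log (x ν 0), fun k k' hkk' => ?_, fun k => ⟨⟨?_, ?_⟩, ?_⟩⟩
    · exact sub_lt_sub_right (Real.log_lt_log (hxpos ν k) (hx ν hkk')) _
    · exact sub_nonneg.mpr (Real.log_le_log (hxpos ν 0) ((hx ν).monotone (Fin.zero_le k)))
    · rw [sub_le_iff_le_add, ← Real.log_mul hR.ne' (hxpos ν 0).ne']
      exact Real.log_le_log (hxpos ν k) (hxR ν k)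
    · rw [← pencil_log_recenter (δs ν) (S ν) (hxpos ν 0) (hxpos ν k)]
      exact hroot ν k

end Summit.ValiantsHypothesis.ValiantsHypothesis.Theorems.LacunarySymmetroidMatrixDescartes.WallBubbling
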